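import Literature.Computability.QuantumComplexity.CubicForrelation

/-!
# `SignedCubicForrelationInPrBPP` — negative knowledge: a biquadratic permutation with no affine component

Support file for crux `stmt-QuantumAdvantage-13933`
(`Summit.QuantumAdvantage.QuantumAdvantage.Theses.CubicForrelation.SignedCubicForrelationInPrBPP`, route
`QuantumAdvantage/CubicForrelation`), written by the standing disprover
refuter-cdisprove-stmt-QuantumAdvantage-13933-0 (2026-08-16).

The route text (CHEAPEST FALSIFIER) names as "the one theorem that kills the signed line" the claim that EVERY
permutation `π` of `𝔽₂^m` which is quadratic with quadratic inverse ("biquadratic"; these are exactly the `π`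
for which the Maiorana–McFarland pair `b = u·π(v) + h(v)`, `b̃ = v·π⁻¹(u) + h(π⁻¹(u))` is a cubic/cubic exact
pair) is TRIANGULARISABLE up to affine equivalence, `A ∘ π ∘ B = τ` with `τ_i(x) = x_i + q_i(x_{<i})` — then the
MM peeling decoder always starts. This file refutes it in the tree's vocabulary (`IsDegLeFun`):

* `xor3_of_isDegLeFun_one` — a Boolean function of algebraic degree `≤ 1` satisfies
  `f(x ⊕ y ⊕ z) = f x ⊕ f y ⊕ f z` (from the affine decomposition of a polynomial of total degree `≤ 1`);
* `goldCubePerm` — `x ↦ x³` on `𝔽₈ = 𝔽₂[α]/(α³+α+1)` in the basis `1, α, α²`, with inverse `x ↦ x⁵`; both are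
  quadratic (`goldCubePerm_isDegLeFun_two`, `goldCubePerm_symm_isDegLeFun_two`, explicit polynomials);
* `goldCubePerm_no_affine_component` — for every `ℓ ≠ 0` the component `x ↦ ℓ·π(x)` is NOT of degree `≤ 1`
  (all seven components of `x³` are quadratic: `x³` is almost bent on `𝔽₈`);
* `exists_biquadratic_perm_without_affine_component` — the packaged counterexample (`m = 3`).

Since the first coordinate of a triangular `τ` is `x₀ + const` and `ℓ := (row 0 of A) ≠ 0` turns `A ∘ π ∘ B = τ`
into an affine component `ℓ·π` of `π` (`affine_component_of_first_coordinate`), the Gold cube is not affinely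
triangularisable. Caveat (not formalised): direct sums of Gold cubes are decomposable, so this kills the universal
peeling LEMMA, not the crux; indecomposable non-triangularisable biquadratic permutations in higher dimension are
the open structural question (kit census j007503).

## References

* C. Carlet, Boolean Functions for Cryptography and Coding Theory, CUP 2021, §2.2 (algebraic degree, affine
  functions), §11.3 (Gold functions, almost bent functions on `𝔽_{2^m}`, `m` odd) — orientation.
* R. Gold, Maximal recursive sequences with 3-valued recursive cross-correlation functions, IEEE Trans. IT 14
  (1968) — the exponent `2^k+1`.
-/

noncomputable section

namespace Summit.QuantumAdvantage.QuantumAdvantage.Theorems.SignedCubicForrelationInPrBPP.Negative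

open Literature.Computability.QuantumComplexity MvPolynomial

variable {m : ℕ}

/-! ### Degree `≤ 1` polynomials are affine -/

/-- Affine decomposition of a polynomial of total degree `≤ 1` over `𝔽₂`:
`p = p(0) + ∑_v c_v X_v`. [folklore] -/
theorem eq_C_add_sum_of_totalDegree_le_one (p : MvPolynomial (Fin m) (ZMod 2)) (hp : p.totalDegree ≤ 1) :
    p = C (coeff 0 p) + ∑ v, C (coeff (Finsupp.single v 1) p) * X v := by
  classical
  apply MvPolynomial.ext
  intro d
  simp only [coeff_add, coeff_C, coeff_sum, coeff_C_mul, coeff_X]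
  by_cases h0 : d = 0
  · subst h0
    rw [if_pos rfl]
    have : ∀ v : Fin m, (Finsupp.single v 1 = (0 : Fin m →₀ ℕ)) = False := fun v =>
      propext ⟨fun h => one_ne_zero (Finsupp.single_eq_zero.1 h), False.elim⟩
    simp [this]
  · rw [if_neg (Ne.symm h0), zero_add]
    by_cases h1 : ∃ v, d = Finsupp.single v 1
    · obtain ⟨v, rfl⟩ := h1
      rw [Finset.sum_eq_single v]
      · rw [if_pos rfl, mul_one]
      · intro w _ hw
        rw [if_neg (fun h => hw (Finsupp.single_left_injective one_ne_zero h)), mul_zero]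
      · simp
    · have hd : coeff d p = 0 := by
        rw [← notMem_support_iff]
        intro hmem
        have hdeg : (d.sum fun _ e => e) ≤ 1 := (le_totalDegree hmem).trans hp
        rcases Nat.le_one_iff_eq_zero_or_eq_one.1 hdeg with h | h
        · exact h0 ((Finsupp.degree_eq_zero_iff d).1 h)
        · exact h1 ((Finsupp.sum_eq_one_iff d).1 h)
      rw [hd]
      symm
      exact Finset.sum_eq_zero fun w _ => by rw [if_neg (fun h => h1 ⟨w, h.symm⟩), mul_zero]

/-- Evaluation of a degree-`≤ 1` polynomial over `𝔽₂` is additive on triples of points: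
`p(u+v+w) = p(u) + p(v) + p(w)` (the constant appears `3 = 1` times). [folklore] -/
theorem eval_add_add_of_totalDegree_le_one (p : MvPolynomial (Fin m) (ZMod 2)) (hp : p.totalDegree ≤ 1)
    (u v w : Fin m → ZMod 2) : eval (u + v + w) p = eval u p + eval v p + eval w p := by
  rw [eq_C_add_sum_of_totalDegree_le_one p hp]
  simp only [map_add, map_sum, map_mul, eval_C, eval_X, Pi.add_apply, mul_add, Finset.sum_add_distrib]
  have hc : coeff 0 p + coeff 0 p = 0 := by generalize coeff 0 p = z; fin_cases z <;> decide
  linear_combination (-1 : ZMod 2) * hc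

/-- coordinatewise XOR on `𝔽₂^m` -/
def bvAdd (x y : Fin m → Bool) : Fin m → Bool := fun i => xor (x i) (y i)

/-- `polyPhase` of a degree-`≤ 1` polynomial satisfies the 3-XOR law. [folklore] -/
theorem polyPhase_xor3 (p : MvPolynomial (Fin m) (ZMod 2)) (hp : p.totalDegree ≤ 1) (x y z : Fin m → Bool) :
    polyPhase p (bvAdd (bvAdd x y) z) = xor (xor (polyPhase p x) (polyPhase p y)) (polyPhase p z) := by
  have ite_xor3 : ∀ a b c : Bool, (if xor (xor a b) c then (1 : ZMod 2) else 0) =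
      (if a then (1 : ZMod 2) else 0) + (if b then (1 : ZMod 2) else 0) + (if c then (1 : ZMod 2) else 0) := by
    intro a b c
    cases a <;> cases b <;> cases c <;> decide
  have hpt : (fun j => if (bvAdd (bvAdd x y) z) j then (1 : ZMod 2) else 0) =
      (fun j => if x j then (1 : ZMod 2) else 0) + (fun j => if y j then (1 : ZMod 2) else 0) +
        (fun j => if z j then (1 : ZMod 2) else 0) := by
    funext j
    exact ite_xor3 (x j) (y j) (z j)
  simp only [polyPhase]
  rw [hpt, eval_add_add_of_totalDegree_le_one p hp]
  generalize eval (fun j => if x j then (1 : ZMod 2) else 0) p = a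
  generalize eval (fun j => if y j then (1 : ZMod 2) else 0) p = b
  generalize eval (fun j => if z j then (1 : ZMod 2) else 0) p = c
  fin_cases a <;> fin_cases b <;> fin_cases c <;> decide

/-- **A Boolean function of algebraic degree `≤ 1` is affine**: `f(x ⊕ y ⊕ z) = f x ⊕ f y ⊕ f z`.
[folklore] -/
theorem xor3_of_isDegLeFun_one {f : (Fin m → Bool) → Bool} (h : IsDegLeFun 1 f) (x y z : Fin m → Bool) :
    f (bvAdd (bvAdd x y) z) = xor (xor (f x) (f y)) (f z) := by
  obtain ⟨p, hp, hf⟩ := h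
  rw [hf, hf, hf, hf]
  exact polyPhase_xor3 p hp x y z

/-! ### The Gold cube on `𝔽₈` -/

/-- `x ↦ x³` on `𝔽₈ = 𝔽₂[α]/(α³+α+1)` in the basis `1, α, α²`: `(a,b,c) ↦ (a+b+c+bc, b+ab+ac, c+ab)`.
[folklore] -/
def goldCube (x : Fin 3 → Bool) : Fin 3 → Bool :=
  ![xor (xor (xor (x 0) (x 1)) (x 2)) (x 1 && x 2),
    xor (xor (x 1) (x 0 && x 1)) (x 0 && x 2),
    xor (x 2) (x 0 && x 1)]

/-- Its inverse `x ↦ x⁵`: `(a,b,c) ↦ (a+b+c+bc, b+c+ac, b+ab+ac)`. [folklore] -/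
def goldFifth (x : Fin 3 → Bool) : Fin 3 → Bool :=
  ![xor (xor (xor (x 0) (x 1)) (x 2)) (x 1 && x 2),
    xor (xor (x 1) (x 2)) (x 0 && x 2),
    xor (xor (x 1) (x 0 && x 1)) (x 0 && x 2)]

/-- The Gold cube as a permutation of `𝔽₂³` (`x³ ∘ x⁵ = x¹⁵ = x`). [folklore] -/
def goldCubePerm : Equiv.Perm (Fin 3 → Bool) where
  toFun := goldCube
  invFun := goldFifth
  left_inv := by decide
  right_inv := by decide

/-- The 𝔽₂ inner product `ℓ · v`. [folklore] -/
def dotB (ℓ v : Fin m → Bool) : Bool :=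
  (List.finRange m).foldr (fun i acc => xor (ℓ i && v i) acc) false

section Degrees

/-- degree bookkeeping: `X_i` -/
theorem deg_X_le (i : Fin 3) : (X i : MvPolynomial (Fin 3) (ZMod 2)).totalDegree ≤ 2 := by
  rw [totalDegree_X]; norm_num

/-- degree bookkeeping: `X_i X_j` -/
theorem deg_XX_le (i j : Fin 3) : (X i * X j : MvPolynomial (Fin 3) (ZMod 2)).totalDegree ≤ 2 :=
  (totalDegree_mul _ _).trans (by rw [totalDegree_X, totalDegree_X])

/-- degree bookkeeping: sums -/
theorem deg_add_le {p q : MvPolynomial (Fin 3) (ZMod 2)} (hp : p.totalDegree ≤ 2) (hq : q.totalDegree ≤ 2) :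
    (p + q).totalDegree ≤ 2 :=
  (totalDegree_add _ _).trans (max_le hp hq)

/-- **`x³` is quadratic** (coordinatewise, explicit polynomials). [folklore] -/
theorem goldCubePerm_isDegLeFun_two : ∀ i, IsDegLeFun 2 fun x => goldCubePerm x i := by
  intro i
  fin_cases i
  · refine ⟨X 0 + X 1 + X 2 + X 1 * X 2,
      deg_add_le (deg_add_le (deg_add_le (deg_X_le 0) (deg_X_le 1)) (deg_X_le 2)) (deg_XX_le 1 2),
      fun x => ?_⟩
    show (xor (xor (xor (x 0) (x 1)) (x 2)) (x 1 && x 2)) = _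
    simp only [polyPhase, map_add, map_mul, eval_X]
    cases x 0 <;> cases x 1 <;> cases x 2 <;> decide
  · refine ⟨X 1 + X 0 * X 1 + X 0 * X 2,
      deg_add_le (deg_add_le (deg_X_le 1) (deg_XX_le 0 1)) (deg_XX_le 0 2), fun x => ?_⟩
    show (xor (xor (x 1) (x 0 && x 1)) (x 0 && x 2)) = _
    simp only [polyPhase, map_add, map_mul, eval_X]
    cases x 0 <;> cases x 1 <;> cases x 2 <;> decide
  · refine ⟨X 2 + X 0 * X 1, deg_add_le (deg_X_le 2) (deg_XX_le 0 1), fun x => ?_⟩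
    show (xor (x 2) (x 0 && x 1)) = _
    simp only [polyPhase, map_add, map_mul, eval_X]
    cases x 0 <;> cases x 1 <;> cases x 2 <;> decide

/-- **`x⁵` is quadratic** (coordinatewise, explicit polynomials). [folklore] -/
theorem goldCubePerm_symm_isDegLeFun_two : ∀ i, IsDegLeFun 2 fun x => goldCubePerm.symm x i := by
  intro i
  fin_cases i
  · refine ⟨X 0 + X 1 + X 2 + X 1 * X 2,
      deg_add_le (deg_add_le (deg_add_le (deg_X_le 0) (deg_X_le 1)) (deg_X_le 2)) (deg_XX_le 1 2),
      fun x => ?_⟩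
    show (xor (xor (xor (x 0) (x 1)) (x 2)) (x 1 && x 2)) = _
    simp only [polyPhase, map_add, map_mul, eval_X]
    cases x 0 <;> cases x 1 <;> cases x 2 <;> decide
  · refine ⟨X 1 + X 2 + X 0 * X 2, deg_add_le (deg_add_le (deg_X_le 1) (deg_X_le 2)) (deg_XX_le 0 2),
      fun x => ?_⟩
    show (xor (xor (x 1) (x 2)) (x 0 && x 2)) = _
    simp only [polyPhase, map_add, map_mul, eval_X]
    cases x 0 <;> cases x 1 <;> cases x 2 <;> decide
  · refine ⟨X 1 + X 0 * X 1 + X 0 * X 2, deg_add_le (deg_add_le (deg_X_le 1) (deg_XX_le 0 1)) (deg_XX_le 0 2),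
      fun x => ?_⟩
    show (xor (xor (x 1) (x 0 && x 1)) (x 0 && x 2)) = _
    simp only [polyPhase, map_add, map_mul, eval_X]
    cases x 0 <;> cases x 1 <;> cases x 2 <;> decide

end Degrees

/-- **No non-zero component of `x³` is affine**: the 3-XOR law fails for each of the seven `ℓ ≠ 0`
(checked by `decide`), so none has algebraic degree `≤ 1`. [folklore] -/
theorem goldCubePerm_no_affine_component (ℓ : Fin 3 → Bool) (hℓ : ℓ ≠ fun _ => false) :
    ¬ IsDegLeFun 1 fun x => dotB ℓ (goldCubePerm x) := by
  intro h
  have h3 := xor3_of_isDegLeFun_one h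
  have key : ∀ ℓ : Fin 3 → Bool, ℓ ≠ (fun _ => false) →
      ¬ ∀ x y z : Fin 3 → Bool, dotB ℓ (goldCubePerm (bvAdd (bvAdd x y) z)) =
        xor (xor (dotB ℓ (goldCubePerm x)) (dotB ℓ (goldCubePerm y))) (dotB ℓ (goldCubePerm z)) := by
    decide
  exact key ℓ hℓ h3

/-- For contrast: a map whose first coordinate is `x₀ + const` (e.g. a triangular one) HAS an affine
component, namely that coordinate (`= e₀ · π`). [folklore] -/
theorem isDegLeFun_one_of_first_coordinate (π : (Fin 3 → Bool) → (Fin 3 → Bool)) (c : Bool)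
    (h : ∀ x, π x 0 = xor (x 0) c) : IsDegLeFun 1 fun x => π x 0 := by
  refine ⟨X 0 + C (if c then 1 else 0), ?_, fun x => ?_⟩
  · exact (totalDegree_add _ _).trans
      (max_le (by rw [totalDegree_X]) (by rw [totalDegree_C]; exact Nat.zero_le _))
  · show π x 0 = _
    rw [h x]
    simp only [polyPhase, map_add, eval_X, eval_C]
    cases x 0 <;> cases c <;> decide

/-- **A biquadratic permutation without affine component** (`m = 3`, the Gold cube): refutes "every
permutation of `𝔽₂^m` that is quadratic with quadratic inverse is triangularisable up to affine
equivalence". [folklore] -/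
theorem exists_biquadratic_perm_without_affine_component :
    ∃ π : Equiv.Perm (Fin 3 → Bool), (∀ i, IsDegLeFun 2 fun x => π x i) ∧
      (∀ i, IsDegLeFun 2 fun x => π.symm x i) ∧
      ∀ ℓ : Fin 3 → Bool, ℓ ≠ (fun _ => false) → ¬ IsDegLeFun 1 fun x => dotB ℓ (π x) :=
  ⟨goldCubePerm, goldCubePerm_isDegLeFun_two, goldCubePerm_symm_isDegLeFun_two,
    goldCubePerm_no_affine_component⟩

end Summit.QuantumAdvantage.QuantumAdvantage.Theorems.SignedCubicForrelationInPrBPP.Negative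

end
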